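import Literature.NumberTheory.EllipticCurves.FormalLogValuesIntegralCoeff
import Literature.NumberTheory.PAdicHodge.AinfRamifiedDivisionTransport
import HarnessLib

/-!
# (HL-eval) for a ramified good model: `log_{W_D}(u₀) = α·log_{E₀}(w₀) + β·𝒞_w(log_{E₀}(Xᵖ))` for a `[p]_{W_D}`-division tower `u` of
# `Ŵ_D(𝔪_{ℂ_F})`, its CM-fibre transport `w` (exact `[p]_{E₀}`-tower at distance `≤ ‖ϖ‖`), and any Hodge line `log_{W_D} ≡ α·log_{E₀} + β·log_{E₀}(Xᵖ)`

Topic `Literature/NumberTheory/PAdicHodge`; namespace `Literature.NumberTheory.PAdicHodge.AinfRamTop`. THEOREMS ONLY (no definition, no named fact,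
no instance, no `sorry`). The reading on `K = ℂ_F`, `A = 𝒪_D = ℤ_p[ϖ]` (`EisensteinRoot.CoeffDisc D`, `[p]_{W_D} = AinfRamTop.mulPC`, `[p]_{E₀} = AinfTop.mulPC`)
of the generic analytic files `SecondKindColmezFunctional{,Transport,HodgeLine}` (J2–J4) and `FormalLogValuesIntegralCoeff`. Notation:
`log_{W_D} := (W.map (𝒪_ℂ.subtype ∘ toCBall)).formalLog ∈ ℂ_F⟦X⟧` (as in `TransportedHodgeLine.exists_transportedHodgeLine`), `ℓ = log_{E₀} := (E₀.map (ℤ → ℂ_F)).formalLog`,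
`ℓ^{(p)} = expand_p ℓ = ℓ(Xᵖ)`, values `G(x) = Σ' [Xʲ]G·xʲ`.

* §1 `pow_mul_tsum_formalLog_mulPC_divisionSeq` — **`pᵐ·log_{W_D}(u_m) = log_{W_D}(u₀)`** along an exact `[p]_{W_D}`-tower of `Ŵ_D(𝔪_{ℂ_F})`; `..._eq_zero` on
  torsion towers (`u₀ = 0`).
* §2 ★★★ `tsum_formalLog_eq_hodgeLine_eval` — **(HL-eval)**: if `‖p^d·[Xⁿ](log_{W_D} − α·ℓ − β·ℓ^{(p)})‖ ≤ 1` for all `n` (the conclusion shape of the landed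
  Hodge line, p768226), `u` is an exact `[p]_{W_D}`-tower and `w` an exact `[p]_{E₀}`-tower with `‖wₙ − uₙ‖ ≤ ‖ϖ‖` (the conclusion shape of the CM-fibre
  transport `exists_unique_int_divisionSeq_of_ramified`, p766713), then with `𝒞 = lim pⁿ·ℓ^{(p)}(wₙ)` (exists, rate `‖p‖ⁿ⁺¹`):
  **`log_{W_D}(u₀) = α·ℓ(w₀) + β·𝒞`**; ★★ `hodgeLine_eval_eq_zero_of_torsion` — on a TORSION tower (`u₀ = 0`): `α·ℓ(w₀) + β·𝒞 = 0`;
  ★★ `exists_transport_tsum_formalLog_eq_hodgeLine_eval` — the same with the transport `w` PRODUCED from `W_D ≡ E₀ (mod ϖ)`.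

Purpose (crux K★ `stmt-BirchSwinnertonDyer-22226`, line `kato_lever`, memo `Lines/kato-lever-K2-ramified-cm-transport.md` §9, J4 at the cells): these are
the θ-values which the transported `A_max`-periods must match (T2): `θ(α·Λ_w + β·φΛ_w) = p^N·log_{W_D}(u₀)` once `θ(Λ_w) = p^N·ℓ(w₀)` and
`θ(φΛ_w) = p^N·𝒞_w(ℓ^{(p)})`; on the Tate module the combination is `Fil¹`-valued (torsion reading). Infrastructure only; BSD / K★ are not proved by
any of this; nothing about elliptic curves over number fields is proved here.

## References
* N. M. Katz, *Crystalline cohomology, Dieudonné modules, and Jacobi sums* (1981), §5.1, Thm. 5.1.4–5.1.5. [Katz1981CrystallineDieudonne]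
* P. Colmez, *Périodes p-adiques des variétés abéliennes*, Math. Ann. 292 (1992), §2. [Colmez1992PeriodesAbeliennes]
* J. H. Silverman, *The Arithmetic of Elliptic Curves* (2009), IV.2.3, Thm. IV.6.4. [SilvermanAEC2009]
-/

noncomputable section

open PowerSeries Filter Topology Field WittVector ValuativeRel
open scoped Classical

namespace Literature.NumberTheory.PAdicHodge

namespace AinfRamTop

open Literature.NumberTheory.GaloisRepresentations Literature.NumberTheory.GaloisRepresentations.IsNonarchimedeanLocalField
open Literature.NumberTheory.GaloisRepresentations.LubinTate Literature.NumberTheory.EllipticCurves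

variable {F : Type} [Field F] [ValuativeRel F] [TopologicalSpace F] [IsNonarchimedeanLocalField F] [CharZero F]
  {p : ℕ} [hpp : Fact p.Prime] {hp : valuation F p < 1} (D : EisensteinRoot F p hp)
  [Fact (¬ IsUnit (p : integerC F))] [CharZero (CompletedAlgClosure F)]

omit [Fact (¬ IsUnit (p : integerC F))] [CharZero (CompletedAlgClosure F)] in
/-- The coefficient map of the Hodge-line file, `𝒪_ℂ.subtype ∘ toCBall : 𝒪_D → ℂ_F`, is the structure map `𝒪_ℂ.subtype ∘ algebraMap 𝒪_D 𝒪_ℂ` of the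
generic files. [folklore] -/
private theorem subtype_comp_toCBall_eq :
    (CBall F).subtype.comp (EisensteinRoot.CoeffDisc.toCBall D) =
      (unitBall (CompletedAlgClosure F)).subtype.comp (algebraMap (EisensteinRoot.CoeffDisc D) (CBall F)) := rfl

/-! ## §1 `pᵐ·log_{W_D}(u_m) = log_{W_D}(u₀)` along `[p]_{W_D}`-towers of `Ŵ_D(𝔪_{ℂ_F})` -/

/-- ★ **`pᵐ·log_{W_D}(u_m) = log_{W_D}(u₀)`** along an exact `[p]_{W_D}`-division tower `u` of `Ŵ_D(𝔪_{ℂ_F})` (`AinfRamTop.mulPC W (u (n+1)) = u n`), for a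
Weierstrass equation `W` over the ramified `𝒪_D`. [cite: SilvermanAEC2009, Thm. IV.6.4] -/
theorem pow_mul_tsum_formalLog_mulPC_divisionSeq (W : WeierstrassCurve (EisensteinRoot.CoeffDisc D)) (u : ℕ → (maxNilIdealC F).toIdeal)
    (hu : ∀ n, AinfRamTop.mulPC (D := D) W (u (n + 1)) = u n) (m : ℕ) :
    (p : CompletedAlgClosure F) ^ m *
        ∑' j : ℕ, PowerSeries.coeff j (W.map ((CBall F).subtype.comp (EisensteinRoot.CoeffDisc.toCBall D))).formalLog *
          (((u m : (maxNilIdealC F).toIdeal) : CBall F) : CompletedAlgClosure F) ^ j =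
      ∑' j : ℕ, PowerSeries.coeff j (W.map ((CBall F).subtype.comp (EisensteinRoot.CoeffDisc.toCBall D))).formalLog *
        (((u 0 : (maxNilIdealC F).toIdeal) : CBall F) : CompletedAlgClosure F) ^ j := by
  rw [subtype_comp_toCBall_eq]
  exact pow_mul_tsum_coeff_formalLog_map_divisionSeq (K := CompletedAlgClosure F) W norm_natCast_C_lt_one' u hu m

/-- **Torsion towers**: if `u₀ = 0` then `pᵐ·log_{W_D}(u_m) = 0`. [cite: SilvermanAEC2009, Thm. IV.6.4] -/
theorem pow_mul_tsum_formalLog_mulPC_divisionSeq_eq_zero (W : WeierstrassCurve (EisensteinRoot.CoeffDisc D)) (u : ℕ → (maxNilIdealC F).toIdeal)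
    (hu : ∀ n, AinfRamTop.mulPC (D := D) W (u (n + 1)) = u n) (hu0 : (((u 0 : (maxNilIdealC F).toIdeal) : CBall F) : CompletedAlgClosure F) = 0)
    (m : ℕ) :
    (p : CompletedAlgClosure F) ^ m *
        ∑' j : ℕ, PowerSeries.coeff j (W.map ((CBall F).subtype.comp (EisensteinRoot.CoeffDisc.toCBall D))).formalLog *
          (((u m : (maxNilIdealC F).toIdeal) : CBall F) : CompletedAlgClosure F) ^ j = 0 := by
  rw [subtype_comp_toCBall_eq]
  exact pow_mul_tsum_coeff_formalLog_map_divisionSeq_eq_zero (K := CompletedAlgClosure F) W norm_natCast_C_lt_one' u hu hu0 m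

/-! ## §2 (HL-eval) at the cells -/

omit hpp [Fact (¬ IsUnit (p : integerC F))] [CharZero F] [CharZero (CompletedAlgClosure F)] in
/-- From the Hodge-line shape `‖p^d·c‖ ≤ 1` to the bound `‖c‖ ≤ (‖p‖^d)⁻¹` used by the generic file (`p ≠ 0` in `ℂ_F`). [folklore] -/
private theorem norm_le_inv_pow_of_norm_pow_mul_le_one (hp0 : (p : CompletedAlgClosure F) ≠ 0) {c : CompletedAlgClosure F} {d : ℕ}
    (h : ‖(p : CompletedAlgClosure F) ^ d * c‖ ≤ 1) : ‖c‖ ≤ (‖(p : CompletedAlgClosure F)‖ ^ d)⁻¹ := by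
  have hpd : 0 < ‖(p : CompletedAlgClosure F)‖ ^ d := pow_pos (norm_pos_iff.2 hp0) d
  rw [norm_mul, norm_pow, mul_comm] at h
  rw [← one_div]
  exact (le_div_iff₀ hpd).2 h

/-- ★★★ **(HL-eval) for a ramified good model.** Let `W/𝒪_D`, `E₀/ℤ`, `α, β ∈ ℂ_F`, `d ∈ ℕ` with the HODGE LINE
`‖p^d·[Xⁿ](log_{W_D} − α·ℓ − β·ℓ^{(p)})‖ ≤ 1` for all `n` (`ℓ = log_{E₀}`; the conclusion of `TransportedHodgeLine.exists_transportedHodgeLine` with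
`α = Σ aᵢϖⁱ`, `β = Σ bᵢϖⁱ`); let `u` be an exact `[p]_{W_D}`-division tower of `Ŵ_D(𝔪_{ℂ_F})` and `w` an exact `[p]_{E₀}`-division tower with
`‖wₙ − uₙ‖ ≤ ‖ϖ‖` (its CM-fibre transport, `exists_unique_int_divisionSeq_of_ramified`). Then the Colmez functional `𝒞 = lim pⁿ·ℓ^{(p)}(wₙ)` exists
(rate `‖𝒞 − pⁿℓ^{(p)}(wₙ)‖ ≤ ‖p‖ⁿ·‖p‖`) and **`log_{W_D}(u₀) = α·ℓ(w₀) + β·𝒞`**.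
[cite: Katz1981CrystallineDieudonne, §5.1, Thm. 5.1.4–5.1.5] [cite: Colmez1992PeriodesAbeliennes, §2] -/
theorem tsum_formalLog_eq_hodgeLine_eval (W : WeierstrassCurve (EisensteinRoot.CoeffDisc D)) (E₀ : WeierstrassCurve ℤ)
    (α β : CompletedAlgClosure F) (d : ℕ)
    (hHL : ∀ n : ℕ, ‖(p : CompletedAlgClosure F) ^ d * PowerSeries.coeff n
        ((W.map ((CBall F).subtype.comp (EisensteinRoot.CoeffDisc.toCBall D))).formalLog -
          PowerSeries.C α * (E₀.map (Int.castRingHom (CompletedAlgClosure F))).formalLog -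
          PowerSeries.C β * PowerSeries.expand p hpp.out.ne_zero (E₀.map (Int.castRingHom (CompletedAlgClosure F))).formalLog)‖ ≤ 1)
    (u w : ℕ → (maxNilIdealC F).toIdeal) (hu : ∀ n, AinfRamTop.mulPC (D := D) W (u (n + 1)) = u n)
    (hw : ∀ n, AinfTop.mulPC F p E₀ (w (n + 1)) = w n)
    (hwu : ∀ n, ‖(((w n : (maxNilIdealC F).toIdeal) : CBall F) : CompletedAlgClosure F) -
      (((u n : (maxNilIdealC F).toIdeal) : CBall F) : CompletedAlgClosure F)‖ ≤ ‖((D.rootC : integerC F) : CompletedAlgClosure F)‖) :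
    ∃ 𝒞 : CompletedAlgClosure F,
      Tendsto (fun m : ℕ => (p : CompletedAlgClosure F) ^ m *
        ∑' j : ℕ, PowerSeries.coeff j (PowerSeries.expand p hpp.out.ne_zero (E₀.map (Int.castRingHom (CompletedAlgClosure F))).formalLog) *
          (((w m : (maxNilIdealC F).toIdeal) : CBall F) : CompletedAlgClosure F) ^ j) atTop (𝓝 𝒞) ∧
      (∀ m : ℕ, ‖𝒞 - (p : CompletedAlgClosure F) ^ m *
        ∑' j : ℕ, PowerSeries.coeff j (PowerSeries.expand p hpp.out.ne_zero (E₀.map (Int.castRingHom (CompletedAlgClosure F))).formalLog) *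
          (((w m : (maxNilIdealC F).toIdeal) : CBall F) : CompletedAlgClosure F) ^ j‖ ≤
        ‖(p : CompletedAlgClosure F)‖ ^ m * ‖(p : CompletedAlgClosure F)‖) ∧
      ∑' j : ℕ, PowerSeries.coeff j (W.map ((CBall F).subtype.comp (EisensteinRoot.CoeffDisc.toCBall D))).formalLog *
          (((u 0 : (maxNilIdealC F).toIdeal) : CBall F) : CompletedAlgClosure F) ^ j =
        α * ∑' j : ℕ, PowerSeries.coeff j (E₀.map (Int.castRingHom (CompletedAlgClosure F))).formalLog *
            (((w 0 : (maxNilIdealC F).toIdeal) : CBall F) : CompletedAlgClosure F) ^ j + β * 𝒞 := by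
  have hp0 : (p : CompletedAlgClosure F) ≠ 0 := Nat.cast_ne_zero.2 hpp.out.ne_zero
  have hB : ∀ n : ℕ, ‖PowerSeries.coeff n
      ((W.map ((CBall F).subtype.comp (EisensteinRoot.CoeffDisc.toCBall D))).formalLog -
        PowerSeries.C α * (E₀.map (Int.castRingHom (CompletedAlgClosure F))).formalLog -
        PowerSeries.C β * PowerSeries.expand p hpp.out.ne_zero (E₀.map (Int.castRingHom (CompletedAlgClosure F))).formalLog)‖ ≤
      (‖(p : CompletedAlgClosure F)‖ ^ d)⁻¹ := fun n => norm_le_inv_pow_of_norm_pow_mul_le_one hp0 (hHL n)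
  exact tsum_eq_of_hodgeLine_of_pow_mul_tsum_eq (K := CompletedAlgClosure F) E₀ norm_natCast_C_lt_one' _ α β hB D.norm_rootC_lt_one u w hw hwu
    (pow_mul_tsum_formalLog_mulPC_divisionSeq D W u hu)

/-- ★★ **(HL-eval) on TORSION towers of the ramified model.** In the situation of `tsum_formalLog_eq_hodgeLine_eval`, if `u₀ = 0` (a `[p]_{W_D}`-division
tower of the origin, i.e. an element of the Tate module `T_pŴ_D`), then **`α·ℓ(w₀) + β·𝒞_w(ℓ^{(p)}) = 0`**: the Hodge combination of the transported
functionals vanishes on the Tate module (although `w₀ = (Tu)₀ ≠ 0` in general). [cite: Katz1981CrystallineDieudonne, §5.1, Thm. 5.1.4–5.1.5] -/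
theorem hodgeLine_eval_eq_zero_of_torsion (W : WeierstrassCurve (EisensteinRoot.CoeffDisc D)) (E₀ : WeierstrassCurve ℤ)
    (α β : CompletedAlgClosure F) (d : ℕ)
    (hHL : ∀ n : ℕ, ‖(p : CompletedAlgClosure F) ^ d * PowerSeries.coeff n
        ((W.map ((CBall F).subtype.comp (EisensteinRoot.CoeffDisc.toCBall D))).formalLog -
          PowerSeries.C α * (E₀.map (Int.castRingHom (CompletedAlgClosure F))).formalLog -
          PowerSeries.C β * PowerSeries.expand p hpp.out.ne_zero (E₀.map (Int.castRingHom (CompletedAlgClosure F))).formalLog)‖ ≤ 1)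
    (u w : ℕ → (maxNilIdealC F).toIdeal) (hu : ∀ n, AinfRamTop.mulPC (D := D) W (u (n + 1)) = u n)
    (hu0 : (((u 0 : (maxNilIdealC F).toIdeal) : CBall F) : CompletedAlgClosure F) = 0)
    (hw : ∀ n, AinfTop.mulPC F p E₀ (w (n + 1)) = w n)
    (hwu : ∀ n, ‖(((w n : (maxNilIdealC F).toIdeal) : CBall F) : CompletedAlgClosure F) -
      (((u n : (maxNilIdealC F).toIdeal) : CBall F) : CompletedAlgClosure F)‖ ≤ ‖((D.rootC : integerC F) : CompletedAlgClosure F)‖) :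
    ∃ 𝒞 : CompletedAlgClosure F,
      Tendsto (fun m : ℕ => (p : CompletedAlgClosure F) ^ m *
        ∑' j : ℕ, PowerSeries.coeff j (PowerSeries.expand p hpp.out.ne_zero (E₀.map (Int.castRingHom (CompletedAlgClosure F))).formalLog) *
          (((w m : (maxNilIdealC F).toIdeal) : CBall F) : CompletedAlgClosure F) ^ j) atTop (𝓝 𝒞) ∧
      α * ∑' j : ℕ, PowerSeries.coeff j (E₀.map (Int.castRingHom (CompletedAlgClosure F))).formalLog *
            (((w 0 : (maxNilIdealC F).toIdeal) : CBall F) : CompletedAlgClosure F) ^ j + β * 𝒞 = 0 := by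
  have hp0 : (p : CompletedAlgClosure F) ≠ 0 := Nat.cast_ne_zero.2 hpp.out.ne_zero
  have hB : ∀ n : ℕ, ‖PowerSeries.coeff n
      ((W.map ((CBall F).subtype.comp (EisensteinRoot.CoeffDisc.toCBall D))).formalLog -
        PowerSeries.C α * (E₀.map (Int.castRingHom (CompletedAlgClosure F))).formalLog -
        PowerSeries.C β * PowerSeries.expand p hpp.out.ne_zero (E₀.map (Int.castRingHom (CompletedAlgClosure F))).formalLog)‖ ≤
      (‖(p : CompletedAlgClosure F)‖ ^ d)⁻¹ := fun n => norm_le_inv_pow_of_norm_pow_mul_le_one hp0 (hHL n)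
  exact hodgeLine_eval_eq_zero_of_pow_mul_tsum_eq_zero (K := CompletedAlgClosure F) E₀ norm_natCast_C_lt_one' _ α β hB D.norm_rootC_lt_one u w
    hw hwu (pow_mul_tsum_formalLog_mulPC_divisionSeq_eq_zero D W u hu hu0)

/-- ★★ **(HL-eval) with the transport produced.** For `W_D ≡ E₀ ⊗ 𝒪_D (mod ϖ)` (hypothesis `hWE` of the CM-fibre transport), a Hodge line as above and an
exact `[p]_{W_D}`-division tower `u`: there are an exact `[p]_{E₀}`-division tower `w` with `‖wₙ − uₙ‖ ≤ ‖ϖ‖` (the transport `Tu`) and the Colmez functional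
`𝒞 = lim pⁿ·ℓ^{(p)}(wₙ)` with **`log_{W_D}(u₀) = α·ℓ(w₀) + β·𝒞`**. [cite: Katz1981CrystallineDieudonne, §5.1, Thm. 5.1.4–5.1.5] [cite: Colmez1992PeriodesAbeliennes, §2] -/
theorem exists_transport_tsum_formalLog_eq_hodgeLine_eval (W : WeierstrassCurve (EisensteinRoot.CoeffDisc D)) (E₀ : WeierstrassCurve ℤ)
    (hWE : W.map (Ideal.Quotient.mk (Ideal.span {EisensteinRoot.CoeffDisc.of D (AdjoinRoot.root D.poly)})) =
      (E₀.map (algebraMap ℤ (EisensteinRoot.CoeffDisc D))).map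
        (Ideal.Quotient.mk (Ideal.span {EisensteinRoot.CoeffDisc.of D (AdjoinRoot.root D.poly)})))
    (α β : CompletedAlgClosure F) (d : ℕ)
    (hHL : ∀ n : ℕ, ‖(p : CompletedAlgClosure F) ^ d * PowerSeries.coeff n
        ((W.map ((CBall F).subtype.comp (EisensteinRoot.CoeffDisc.toCBall D))).formalLog -
          PowerSeries.C α * (E₀.map (Int.castRingHom (CompletedAlgClosure F))).formalLog -
          PowerSeries.C β * PowerSeries.expand p hpp.out.ne_zero (E₀.map (Int.castRingHom (CompletedAlgClosure F))).formalLog)‖ ≤ 1)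
    (u : ℕ → (maxNilIdealC F).toIdeal) (hu : ∀ n, AinfRamTop.mulPC (D := D) W (u (n + 1)) = u n) :
    ∃ (w : ℕ → (maxNilIdealC F).toIdeal) (𝒞 : CompletedAlgClosure F),
      (∀ n, AinfTop.mulPC F p E₀ (w (n + 1)) = w n) ∧
      (∀ n, ‖(((w n : (maxNilIdealC F).toIdeal) : CBall F) : CompletedAlgClosure F) -
        (((u n : (maxNilIdealC F).toIdeal) : CBall F) : CompletedAlgClosure F)‖ ≤ ‖((D.rootC : integerC F) : CompletedAlgClosure F)‖) ∧
      Tendsto (fun m : ℕ => (p : CompletedAlgClosure F) ^ m *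
        ∑' j : ℕ, PowerSeries.coeff j (PowerSeries.expand p hpp.out.ne_zero (E₀.map (Int.castRingHom (CompletedAlgClosure F))).formalLog) *
          (((w m : (maxNilIdealC F).toIdeal) : CBall F) : CompletedAlgClosure F) ^ j) atTop (𝓝 𝒞) ∧
      ∑' j : ℕ, PowerSeries.coeff j (W.map ((CBall F).subtype.comp (EisensteinRoot.CoeffDisc.toCBall D))).formalLog *
          (((u 0 : (maxNilIdealC F).toIdeal) : CBall F) : CompletedAlgClosure F) ^ j =
        α * ∑' j : ℕ, PowerSeries.coeff j (E₀.map (Int.castRingHom (CompletedAlgClosure F))).formalLog *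
            (((w 0 : (maxNilIdealC F).toIdeal) : CBall F) : CompletedAlgClosure F) ^ j + β * 𝒞 := by
  obtain ⟨w, ⟨hw, hwu⟩, -⟩ := exists_unique_int_divisionSeq_of_ramified D W E₀ hWE hu
  obtain ⟨𝒞, h𝒞, -, heval⟩ := tsum_formalLog_eq_hodgeLine_eval D W E₀ α β d hHL u w hu hw hwu
  exact ⟨w, 𝒞, hw, hwu, h𝒞, heval⟩

end AinfRamTop

end Literature.NumberTheory.PAdicHodge
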